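import Summits.KontsevichZagierPeriods.KontsevichZagierPeriods.Theses.HermiteRigidity
import Summits.KontsevichZagierPeriods.KontsevichZagierPeriods.Theorems.GenusTwoCycleTransfer.Negative.Witnesses
import Summits.KontsevichZagierPeriods.KontsevichZagierPeriods.Theorems.GenusTwoCycleTransfer.Negative.LoadBearing
import Literature.NumberTheory.Transcendental.EllIterRep
import Literature.NumberTheory.Transcendental.SemialgebraicMapsProofs
import Literature.NumberTheory.Transcendental.KZSubcalculusInvariants
import Literature.NumberTheory.Transcendental.KZLogCalculusProofs
import Literature.NumberTheory.Transcendental.KZKernelConjectureForms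

/-!
# Disproof of `GenusTwoCycleTransfer` (crux stmt-KontsevichZagierPeriods-3408) — findings

Standing-disprover (refuter, `cdisprove`) work file for the crux
`Summit.KontsevichZagierPeriods.KontsevichZagierPeriods.Theses.HermiteRigidity.GenusTwoCycleTransfer`
of route HermiteRigidity: for `f = x(x−1)(x−2)(x−3)(x−5)` and ANY `r₁ r₂ r₃ : KZ.IntegralRep 1`
with domains `(0,1)`, `(2,3)`, `(5,∞)` and integrand `1/√f` on them,
`[r₁] − [r₂] + [r₃] ∈ KZ.relations`.

## Verdict of cycle 1 (2026-08-16): NO KILL — the crux is true, and here is why it resists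

* `GenusTwoCycleTransfer_of_kontsevichZagierPeriods` (§6; LANDED as
  `GenusTwoCycleTransferNegative.genusTwoCycleTransfer_of_kontsevichZagierPeriods`, p73324): the crux
  FOLLOWS from the summit statement plus the single real-number identity `I₁ − I₂ + I₃ = 0`
  (`I₁ = ∫₀¹ dx/√f`, `I₂ = ∫₂³ dx/√f`, `I₃ = ∫₅^∞ dx/√f`; certified numerically to `7·10⁻¹⁶` by four
  independent seats, kit jobs j006883 / j004848, and classically Cauchy's theorem for `dz/√f` on
  the upper half-plane). Hence an additive invariant of `KZ.FormalRep` separating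
  `[r₁] − [r₂] + [r₃]` from `KZ.relations` would refute the (tree-equivalent) kernel form of the
  summit itself: there is no crux-local counterexample to look for.
* Worse for the disprover, the crux is DERIVABLE outright (line `separating-pencil-trace`, picked
  by the lead 2026-08-16T00:04Z): three `KZ.changeOfVariablesRel` instances push the three oval
  integrals forward along `Λ = √(x(x−2)(x−5)/((x−1)(x−3)))` onto `(0,∞)`, where the push-forward
  integrands `2/|∂ₓc_λ(Xᵢ(λ))|` of the interlacing cubic pencil `c_λ = N − λ²D` cancel with signs
  `(+,−,+)` by partial fractions (one `KZ.integrandAddRel` instance). Both registered stubs have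
  LANDED (`stub_semialgebraicInvFunOn` p72023, `stub_pushforwardDimOne` p72124) together with all
  pencil lemmas (p71908); the assembly over them is sorry-free (triage r1-1, `crux_of_pushforwards`).
  I re-derived the lever by hand (§0 of NOTES.md): the weight `(1/√f)/|Λ′| = 2/|c′_λ|` at a root and
  `Σᵢ 1/c′_λ(xᵢ) = 0` for the monic cubic are exact; `Λ` is a bijection of each oval onto `(0,∞)`.
  Nothing is left to attack.

## What is proved (all sorry-free; LANDED under `Theorems/GenusTwoCycleTransfer/Negative/`)

`Witnesses.lean` (p72937) — NON-VACUITY: `exists_rep01/23/5` (`ℚ`-semialgebraic domains and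
  integrand, absolute integrability with the `x^{-1/2}` endpoint singularities and an `x^{-2}`-
  dominated tail) with POSITIVE values; `exists_emptyRep`, `exists_zeroRep`; `value_eq_setIntegral`.
`LoadBearing.lean` (p73324) — `genusTwoCycleTransfer_iff_exists` (the `∀ r₁ r₂ r₃` form is ONE
  instance: congruence mod relations, so the universal quantifier hides nothing);
  `hypotheses_satisfiable`; FORCED MOVES `not_mem_closure_cov_nl` (not derivable by rules (2)+(3)
  alone: coefficient sum `1`) and `not_mem_closure_add` (not by the additivity rules alone:
  restricted evaluation through `(5,∞)` is `I₃ > 0`) — the pencil derivation uses exactly rules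
  (2)+(1b); SIX LOAD-BEARING THEOREMS `genusTwoCycleTransfer_false_without_{domain,integrand}{₁,₂,₃}`
  (the crux verbatim minus one hypothesis is FALSE; two admissible witnesses of different value
  cannot both give relations); `all_plus_not_mem_relations`; `…_of_kontsevichZagierPeriods`.
`Bounds.lean` (p73395) + `OvalOrder.lean` (proposed; not imported here until the farm has built them) — PERIOD ENCLOSURES by `∫ dx/√((x−a)(a+1−x)) =
  arcsin(2x−2a−1)` and an `x^{-5/2}` tail: `I₁ ≤ (π/2)(1/√(135/8)+1/√8) = 0.9378…`,
  `π/√30 = 0.5736… ≤ I₁`, `(π/2)(1/√(75/8)+1/√12) = 0.9665… ≤ I₂`, `1/√3 ≤ I₂`,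
  `I₃ ≤ 2/√120 + (10/3)/14 = 0.4207…`; hence `I₃ < I₁ < I₂` (`I₃_lt_I₁`, `I₁_lt_I₂`, `I₃_lt_I₂`):
  NO TWO OVALS ARE KZ-EQUIVALENT (`not_equivalent₁₂/₁₃/₂₃` — the genus-2 relation is irreducibly
  three-term, unlike genus 1 where `TwoTorsionTransfer` relates two ovals), and
  `sign_pattern_of_mem_relations`: among the eight `±[r₁] ± [r₂] ± [r₃]` only `±([r₁] − [r₂] + [r₃])`
  can be a relation.
This work file keeps the original `def`-based versions (`rep01`, `GenusTwoCycleTransferWithout…`)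
for readability; §7 points to the landed modules.

`-- Targets`: none this cycle (payload `stuck_stubs = []`; both registered stubs already closed).
Near-misses: none — every statement attempted here closed. Open curiosity (not load-bearing for
anyone): is the relation derivable WITHOUT rule (2), i.e. inside additivity + Newton–Leibniz? No
window/weight invariant survives rule (3) (it peels the last coordinate, forcing constant weights),
and no derivation is known.
-/

noncomputable section

set_option linter.dupNamespace false

open Set MeasureTheory MvPolynomial
open Literature.NumberTheory.Transcendental Literature.ModelTheory.ExponentialFields
open Summit.KontsevichZagierPeriods.KontsevichZagierPeriods.Theses.HermiteRigidity (GenusTwoCycleTransfer)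

namespace Summit.KontsevichZagierPeriods.KontsevichZagierPeriods.Cruxes.GenusTwoCycleTransfer.Disproof

/-! ### §0 The data of the crux -/

/-- The quintic `f(x) = x(x−1)(x−2)(x−3)(x−5)` of the crux, as a real function. -/
def quintic (x : ℝ) : ℝ := x * (x - 1) * (x - 2) * (x - 3) * (x - 5)

@[simp] theorem quintic_apply (x : ℝ) : quintic x = x * (x - 1) * (x - 2) * (x - 3) * (x - 5) := rfl

/-- The integrand `1/√f` read on `ℝ¹ = (Fin 1 → ℝ)`, written exactly as in the crux. -/
def ig (p : Fin 1 → ℝ) : ℝ := 1 / Real.sqrt (p 0 * (p 0 - 1) * (p 0 - 2) * (p 0 - 3) * (p 0 - 5))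

/-- The first oval `(0,1)`. -/
def dom01 : Set (Fin 1 → ℝ) := {p | 0 < p 0 ∧ p 0 < 1}
/-- The second oval `(2,3)`. -/
def dom23 : Set (Fin 1 → ℝ) := {p | 2 < p 0 ∧ p 0 < 3}
/-- The unbounded oval `(5,∞)`. -/
def dom5 : Set (Fin 1 → ℝ) := {p | 5 < p 0}

theorem dom01_eq : dom01 = {p : Fin 1 → ℝ | p 0 ∈ Ioo (0:ℝ) 1} := rfl
theorem dom23_eq : dom23 = {p : Fin 1 → ℝ | p 0 ∈ Ioo (2:ℝ) 3} := rfl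
theorem dom5_eq : dom5 = {p : Fin 1 → ℝ | p 0 ∈ Ioi (5:ℝ)} := rfl

/-! ### §1 Semialgebraicity of the data -/

theorem isSemialgebraic_dom01 : IsSemialgebraic ℚ dom01 := isSemialgebraic_unitInterval_fin_one

theorem isSemialgebraic_dom23 : IsSemialgebraic ℚ dom23 := by
  have h1 := Literature.ModelTheory.ExponentialFields.isSemialgebraic_setOf_eval_lt (k := ℚ)
    (R := ℝ) (2 : MvPolynomial (Fin 1) ℚ) (X 0 : MvPolynomial (Fin 1) ℚ)
  have h2 := Literature.ModelTheory.ExponentialFields.isSemialgebraic_setOf_eval_lt (k := ℚ)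
    (R := ℝ) (X 0 : MvPolynomial (Fin 1) ℚ) (3 : MvPolynomial (Fin 1) ℚ)
  simp only [aeval_X, map_ofNat] at h1 h2
  exact h1.inter h2

theorem isSemialgebraic_dom5 : IsSemialgebraic ℚ dom5 := by
  have h1 := Literature.ModelTheory.ExponentialFields.isSemialgebraic_setOf_eval_lt (k := ℚ)
    (R := ℝ) (5 : MvPolynomial (Fin 1) ℚ) (X 0 : MvPolynomial (Fin 1) ℚ)
  simp only [aeval_X, map_ofNat] at h1
  exact h1

/-- `1/√f` is a `ℚ`-semialgebraic function on any `ℚ`-semialgebraic set where `f > 0`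
(it is `√(1/f)`, a square root of a rational function). -/
theorem ig_semialgebraic {σ : Set (Fin 1 → ℝ)} (hσ : IsSemialgebraic ℚ σ)
    (hf : ∀ p ∈ σ, 0 < quintic (p 0)) : IsSemialgebraicFunOn ℚ σ ig := by
  have h1 := isSemialgebraicFunOn_aeval_div_aeval hσ (1 : MvPolynomial (Fin 1) ℚ)
    (X 0 * (X 0 - 1) * (X 0 - 2) * (X 0 - 3) * (X 0 - 5)) (fun p hp => by
      simpa using (hf p hp).ne')
  have h2 : IsSemialgebraicFunOn ℚ σ (fun p => 1 / (p 0 * (p 0 - 1) * (p 0 - 2) * (p 0 - 3) * (p 0 - 5))) :=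
    h1.congr (fun p _ => by simp)
  have h3 := IsSemialgebraicFunOn.sqrt_holds h2
  refine h3.congr (fun p _ => ?_)
  simp only [ig, one_div, Real.sqrt_inv]

/-! ### §2 Absolute integrability on the three ovals (on `ℝ`, then on `ℝ¹`) -/

theorem measurable_inv_sqrt_quintic : Measurable (fun x : ℝ => 1 / Real.sqrt (quintic x)) := by
  unfold quintic
  fun_prop

/-- For `0 < s < 1`: `(√s √(1-s))⁻¹ ≤ (√s)⁻¹ + (√(1-s))⁻¹`. -/
theorem inv_sqrt_mul_sqrt_le {s : ℝ} (hs : s ∈ Ioo (0 : ℝ) 1) :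
    (Real.sqrt s * Real.sqrt (1 - s))⁻¹ ≤ (Real.sqrt s)⁻¹ + (Real.sqrt (1 - s))⁻¹ := by
  have h0 : 0 < Real.sqrt s := Real.sqrt_pos.mpr hs.1
  have h1 : 0 < Real.sqrt (1 - s) := Real.sqrt_pos.mpr (by linarith [hs.2])
  have hs0 : Real.sqrt s ^ 2 = s := Real.sq_sqrt hs.1.le
  have hs1 : Real.sqrt (1 - s) ^ 2 = 1 - s := Real.sq_sqrt (by linarith [hs.2])
  have key : 1 ≤ Real.sqrt s + Real.sqrt (1 - s) := by nlinarith [mul_pos h0 h1]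
  rw [inv_le_iff_one_le_mul₀ (mul_pos h0 h1)]
  calc (1 : ℝ) ≤ Real.sqrt s + Real.sqrt (1 - s) := key
    _ = ((Real.sqrt s)⁻¹ + (Real.sqrt (1 - s))⁻¹) * (Real.sqrt s * Real.sqrt (1 - s)) := by
        field_simp; ring

/-- Model singularity: `(√(x−a))⁻¹ + (√(b−x))⁻¹` is integrable on `(a,b)`. -/
theorem integrableOn_model (a b : ℝ) :
    IntegrableOn (fun x : ℝ => (Real.sqrt (x - a))⁻¹ + (Real.sqrt (b - x))⁻¹) (Ioo a b) :=
  (KZ.integrableOn_inv_sqrt_sub_left a b).add (KZ.integrableOn_inv_sqrt_sub_right a b)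

/-- Pointwise domination on a unit-length oval `(a, a+1)` from `(x−a)(a+1−x) ≤ f(x)`. -/
theorem inv_sqrt_le_model {x a : ℝ} (hx : x ∈ Ioo a (a + 1)) {F : ℝ} (hF : (x - a) * (a + 1 - x) ≤ F) :
    1 / Real.sqrt F ≤ (Real.sqrt (x - a))⁻¹ + (Real.sqrt (a + 1 - x))⁻¹ := by
  have hs : x - a ∈ Ioo (0:ℝ) 1 := ⟨by linarith [hx.1], by linarith [hx.2]⟩
  have hpos : 0 < (x - a) * (a + 1 - x) := mul_pos hs.1 (by linarith [hx.2])
  have h1 : 1 / Real.sqrt F ≤ 1 / Real.sqrt ((x - a) * (a + 1 - x)) :=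
    one_div_le_one_div_of_le (Real.sqrt_pos.mpr hpos) (Real.sqrt_le_sqrt hF)
  refine h1.trans ?_
  rw [Real.sqrt_mul hs.1.le, one_div]
  have := inv_sqrt_mul_sqrt_le hs
  have e : 1 - (x - a) = a + 1 - x := by ring
  rw [e] at this
  exact this

theorem quintic_ge_01 {x : ℝ} (hx : x ∈ Ioo (0:ℝ) 1) : (x - 0) * (0 + 1 - x) ≤ quintic x := by
  have hg : (1:ℝ) ≤ (2 - x) * (3 - x) * (5 - x) :=
    one_le_mul_of_one_le_of_one_le (one_le_mul_of_one_le_of_one_le (by linarith [hx.2])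
      (by linarith [hx.2])) (by linarith [hx.2])
  have h0 : 0 ≤ x * (1 - x) := mul_nonneg hx.1.le (by linarith [hx.2])
  have : quintic x = x * (1 - x) * ((2 - x) * (3 - x) * (5 - x)) := by simp [quintic]; ring
  rw [this]
  calc (x - 0) * (0 + 1 - x) = x * (1 - x) * 1 := by ring
    _ ≤ x * (1 - x) * ((2 - x) * (3 - x) * (5 - x)) := mul_le_mul_of_nonneg_left hg h0

theorem quintic_ge_23 {x : ℝ} (hx : x ∈ Ioo (2:ℝ) 3) : (x - 2) * (2 + 1 - x) ≤ quintic x := by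
  have hg : (1:ℝ) ≤ x * (x - 1) * (5 - x) :=
    one_le_mul_of_one_le_of_one_le (one_le_mul_of_one_le_of_one_le (by linarith [hx.1])
      (by linarith [hx.1])) (by linarith [hx.2])
  have h0 : 0 ≤ (x - 2) * (3 - x) := mul_nonneg (by linarith [hx.1]) (by linarith [hx.2])
  have : quintic x = (x - 2) * (3 - x) * (x * (x - 1) * (5 - x)) := by simp [quintic]; ring
  rw [this]
  calc (x - 2) * (2 + 1 - x) = (x - 2) * (3 - x) * 1 := by ring
    _ ≤ (x - 2) * (3 - x) * (x * (x - 1) * (5 - x)) := mul_le_mul_of_nonneg_left hg h0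

theorem quintic_pos_01 {x : ℝ} (hx : x ∈ Ioo (0:ℝ) 1) : 0 < quintic x :=
  lt_of_lt_of_le (by nlinarith [hx.1, hx.2]) (quintic_ge_01 hx)

theorem quintic_pos_23 {x : ℝ} (hx : x ∈ Ioo (2:ℝ) 3) : 0 < quintic x :=
  lt_of_lt_of_le (by nlinarith [hx.1, hx.2]) (quintic_ge_23 hx)

theorem quintic_pos_5 {x : ℝ} (hx : x ∈ Ioi (5:ℝ)) : 0 < quintic x := by
  have hx' : 5 < x := hx
  simp only [quintic]
  have h1 : 0 < x * (x - 1) * (x - 2) * (x - 3) :=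
    mul_pos (mul_pos (mul_pos (by linarith) (by linarith)) (by linarith)) (by linarith)
  exact mul_pos h1 (by linarith)

/-- `1/√f` is integrable on `(0,1)`. -/
theorem integrableOn_Ioo01 : IntegrableOn (fun x : ℝ => 1 / Real.sqrt (quintic x)) (Ioo 0 1) := by
  refine Integrable.mono' (integrableOn_model 0 (0 + 1) |>.mono_set (by norm_num))
    measurable_inv_sqrt_quintic.aestronglyMeasurable ?_
  filter_upwards [ae_restrict_mem measurableSet_Ioo] with x hx
  rw [Real.norm_of_nonneg (by positivity)]
  exact inv_sqrt_le_model (a := 0) (by simpa using hx) (quintic_ge_01 hx)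

/-- `1/√f` is integrable on `(2,3)`. -/
theorem integrableOn_Ioo23 : IntegrableOn (fun x : ℝ => 1 / Real.sqrt (quintic x)) (Ioo 2 3) := by
  refine Integrable.mono' (integrableOn_model 2 (2 + 1) |>.mono_set (by norm_num))
    measurable_inv_sqrt_quintic.aestronglyMeasurable ?_
  filter_upwards [ae_restrict_mem measurableSet_Ioo] with x hx
  rw [Real.norm_of_nonneg (by positivity)]
  exact inv_sqrt_le_model (a := 2) (by norm_num at hx ⊢; exact hx) (quintic_ge_23 hx)

/-- Near the branch point `5`: on `(5,6]`, `x − 5 ≤ f(x)`, so `1/√f ≤ (√(x−5))⁻¹`. -/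
theorem integrableOn_Ioc56 : IntegrableOn (fun x : ℝ => 1 / Real.sqrt (quintic x)) (Ioc 5 6) := by
  rw [integrableOn_Ioc_iff_integrableOn_Ioo]
  refine Integrable.mono' (KZ.integrableOn_inv_sqrt_sub_left 5 6)
    measurable_inv_sqrt_quintic.aestronglyMeasurable ?_
  filter_upwards [ae_restrict_mem measurableSet_Ioo] with x hx
  rw [Real.norm_of_nonneg (by positivity)]
  have hx5 : 0 < x - 5 := by linarith [hx.1]
  have hg : (1:ℝ) ≤ x * (x - 1) * (x - 2) * (x - 3) :=
    one_le_mul_of_one_le_of_one_le (one_le_mul_of_one_le_of_one_le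
      (one_le_mul_of_one_le_of_one_le (by linarith [hx.1]) (by linarith [hx.1]))
      (by linarith [hx.1])) (by linarith [hx.1])
  have hF : x - 5 ≤ quintic x := by
    have : quintic x = (x - 5) * (x * (x - 1) * (x - 2) * (x - 3)) := by simp [quintic]; ring
    rw [this]
    calc x - 5 = (x - 5) * 1 := by ring
      _ ≤ (x - 5) * (x * (x - 1) * (x - 2) * (x - 3)) := mul_le_mul_of_nonneg_left hg hx5.le
  rw [one_div]
  exact inv_anti₀ (Real.sqrt_pos.mpr hx5) (Real.sqrt_le_sqrt hF)

/-- The tail: on `[6,∞)`, `x⁴/225 ≤ f(x)`, so `1/√f ≤ 15 · x^{-2}`, integrable. -/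
theorem integrableOn_Ioi6 : IntegrableOn (fun x : ℝ => 1 / Real.sqrt (quintic x)) (Ioi 6) := by
  have htail : IntegrableOn (fun x : ℝ => 15 * x ^ (-2 : ℝ)) (Ioi 6) :=
    (integrableOn_Ioi_rpow_of_lt (by norm_num) (by norm_num)).const_mul 15
  refine Integrable.mono' htail measurable_inv_sqrt_quintic.aestronglyMeasurable ?_
  filter_upwards [ae_restrict_mem measurableSet_Ioi] with x hx
  have hx6 : 6 < x := hx
  have hx0 : 0 < x := by linarith
  rw [Real.norm_of_nonneg (by positivity)]
  -- f ≥ x⁴ / 225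
  have hF : (x ^ 2 / 15) ^ 2 ≤ quintic x := by
    simp only [quintic]
    nlinarith [mul_pos hx0 hx0, sq_nonneg (x - 6), mul_pos (mul_pos hx0 hx0) (mul_pos hx0 hx0),
      mul_pos (mul_pos hx0 hx0) hx0]
  have hsq : Real.sqrt ((x ^ 2 / 15) ^ 2) = x ^ 2 / 15 := Real.sqrt_sq (by positivity)
  have h1 : 1 / Real.sqrt (quintic x) ≤ 1 / (x ^ 2 / 15) := by
    rw [← hsq]
    exact one_div_le_one_div_of_le (by rw [hsq]; positivity) (Real.sqrt_le_sqrt hF)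
  refine h1.trans (le_of_eq ?_)
  rw [Real.rpow_neg hx0.le, Real.rpow_two]
  field_simp

/-- `1/√f` is integrable on `(5,∞)`. -/
theorem integrableOn_Ioi5 : IntegrableOn (fun x : ℝ => 1 / Real.sqrt (quintic x)) (Ioi 5) := by
  have : Ioi (5:ℝ) = Ioc 5 6 ∪ Ioi 6 := (Ioc_union_Ioi_eq_Ioi (by norm_num)).symm
  rw [this]
  exact integrableOn_Ioc56.union integrableOn_Ioi6

/-- Transfer of integrability from `ℝ` to `ℝ¹`. -/
theorem integrableOn_fin_one {g : ℝ → ℝ} {S : Set ℝ} (h : IntegrableOn g S) :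
    IntegrableOn (fun p : Fin 1 → ℝ => g (p 0)) {p | p 0 ∈ S} := by
  have hmp := MeasureTheory.volume_preserving_funUnique (Fin 1) ℝ
  have hpre : {p : Fin 1 → ℝ | p 0 ∈ S} = MeasurableEquiv.funUnique (Fin 1) ℝ ⁻¹' S := by
    ext x
    simp [MeasurableEquiv.funUnique, Fin.default_eq_zero]
  rw [hpre]
  exact (hmp.integrableOn_comp_preimage (MeasurableEquiv.measurableEmbedding _)).mpr h

/-- Transfer of set integrals from `ℝ¹` to `ℝ`. -/
theorem setIntegral_fin_one (g : ℝ → ℝ) (S : Set ℝ) :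
    ∫ p in {p : Fin 1 → ℝ | p 0 ∈ S}, g (p 0) = ∫ x in S, g x := by
  have hmp := MeasureTheory.volume_preserving_funUnique (Fin 1) ℝ
  have hpre : {p : Fin 1 → ℝ | p 0 ∈ S} = MeasurableEquiv.funUnique (Fin 1) ℝ ⁻¹' S := by
    ext x
    simp [MeasurableEquiv.funUnique, Fin.default_eq_zero]
  have h1 := hmp.setIntegral_preimage_emb (MeasurableEquiv.measurableEmbedding _) g S
  rw [hpre, ← h1]
  rfl

/-- Positivity of `∫_S 1/√f` on a set of positive measure where it is integrable. -/
theorem setIntegral_inv_sqrt_quintic_pos {S : Set ℝ} (hvol : 0 < volume S)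
    (hpos : ∀ x ∈ S, 0 < quintic x)
    (hint : IntegrableOn (fun x : ℝ => 1 / Real.sqrt (quintic x)) S) :
    0 < ∫ x in S, 1 / Real.sqrt (quintic x) := by
  rw [setIntegral_pos_iff_support_of_nonneg_ae (Filter.Eventually.of_forall fun x => by positivity) hint]
  have : Function.support (fun x : ℝ => 1 / Real.sqrt (quintic x)) ∩ S = S := by
    refine inter_eq_right.mpr fun x hx => ?_
    rw [Function.mem_support]
    exact (one_div_pos.mpr (Real.sqrt_pos.mpr (hpos x hx))).ne'
  rwa [this]

/-! ### §3 The canonical witnesses and non-vacuity -/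

/-- The canonical representation `[(0,1), 1/√f]`. -/
def rep01 : KZ.IntegralRep 1 where
  domain := dom01
  integrand := ig
  isSemialgebraic_domain := isSemialgebraic_dom01
  isSemialgebraicFunOn_integrand :=
    ig_semialgebraic isSemialgebraic_dom01 fun p hp => quintic_pos_01 hp
  integrableOn := by
    rw [dom01_eq]
    exact integrableOn_fin_one (g := fun x => 1 / Real.sqrt (quintic x)) integrableOn_Ioo01

/-- The canonical representation `[(2,3), 1/√f]`. -/
def rep23 : KZ.IntegralRep 1 where
  domain := dom23
  integrand := ig
  isSemialgebraic_domain := isSemialgebraic_dom23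
  isSemialgebraicFunOn_integrand :=
    ig_semialgebraic isSemialgebraic_dom23 fun p hp => quintic_pos_23 hp
  integrableOn := by
    rw [dom23_eq]
    exact integrableOn_fin_one (g := fun x => 1 / Real.sqrt (quintic x)) integrableOn_Ioo23

/-- The canonical representation `[(5,∞), 1/√f]`. -/
def rep5 : KZ.IntegralRep 1 where
  domain := dom5
  integrand := ig
  isSemialgebraic_domain := isSemialgebraic_dom5
  isSemialgebraicFunOn_integrand :=
    ig_semialgebraic isSemialgebraic_dom5 fun p hp => quintic_pos_5 hp
  integrableOn := by
    rw [dom5_eq]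
    exact integrableOn_fin_one (g := fun x => 1 / Real.sqrt (quintic x)) integrableOn_Ioi5

@[simp] theorem rep01_domain : rep01.domain = dom01 := rfl
@[simp] theorem rep23_domain : rep23.domain = dom23 := rfl
@[simp] theorem rep5_domain : rep5.domain = dom5 := rfl
@[simp] theorem rep01_integrand : rep01.integrand = ig := rfl
@[simp] theorem rep23_integrand : rep23.integrand = ig := rfl
@[simp] theorem rep5_integrand : rep5.integrand = ig := rfl

theorem value_rep01 : rep01.value = ∫ x in Ioo (0:ℝ) 1, 1 / Real.sqrt (quintic x) := by
  rw [KZ.IntegralRep.value, rep01_domain, dom01_eq]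
  exact setIntegral_fin_one (fun x => 1 / Real.sqrt (quintic x)) (Ioo 0 1)

theorem value_rep23 : rep23.value = ∫ x in Ioo (2:ℝ) 3, 1 / Real.sqrt (quintic x) := by
  rw [KZ.IntegralRep.value, rep23_domain, dom23_eq]
  exact setIntegral_fin_one (fun x => 1 / Real.sqrt (quintic x)) (Ioo 2 3)

theorem value_rep5 : rep5.value = ∫ x in Ioi (5:ℝ), 1 / Real.sqrt (quintic x) := by
  rw [KZ.IntegralRep.value, rep5_domain, dom5_eq]
  exact setIntegral_fin_one (fun x => 1 / Real.sqrt (quintic x)) (Ioi 5)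

/-- `I₁ > 0`. -/
theorem value_rep01_pos : 0 < rep01.value := by
  rw [value_rep01]
  exact setIntegral_inv_sqrt_quintic_pos (by simp) (fun x hx => quintic_pos_01 hx)
    integrableOn_Ioo01

/-- `I₂ > 0`. -/
theorem value_rep23_pos : 0 < rep23.value := by
  rw [value_rep23]
  exact setIntegral_inv_sqrt_quintic_pos (by simp; norm_num)
    (fun x hx => quintic_pos_23 hx) integrableOn_Ioo23

/-- `I₃ > 0`. -/
theorem value_rep5_pos : 0 < rep5.value := by
  rw [value_rep5]
  exact setIntegral_inv_sqrt_quintic_pos (by simp) (fun x hx => quintic_pos_5 hx)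
    integrableOn_Ioi5

/-- The zero-integrand representation on a `ℚ`-semialgebraic set (value `0`). -/
def zeroRep {σ : Set (Fin 1 → ℝ)} (hσ : IsSemialgebraic ℚ σ) : KZ.IntegralRep 1 where
  domain := σ
  integrand := 0
  isSemialgebraic_domain := hσ
  isSemialgebraicFunOn_integrand := (isSemialgebraicFunOn_aeval hσ 0).congr fun _ _ => by simp
  integrableOn := integrableOn_zero

@[simp] theorem zeroRep_domain {σ : Set (Fin 1 → ℝ)} (hσ : IsSemialgebraic ℚ σ) :
    (zeroRep hσ).domain = σ := rfl

@[simp] theorem value_zeroRep {σ : Set (Fin 1 → ℝ)} (hσ : IsSemialgebraic ℚ σ) :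
    (zeroRep hσ).value = 0 := by
  simp [KZ.IntegralRep.value, zeroRep]

/-- The representation with EMPTY domain and integrand `1/√f` (value `0`): it satisfies every
integrand hypothesis of the crux and none of the domain hypotheses. -/
def emptyRep : KZ.IntegralRep 1 where
  domain := ∅
  integrand := ig
  isSemialgebraic_domain := isSemialgebraic_empty
  isSemialgebraicFunOn_integrand := (isSemialgebraicFunOn_aeval isSemialgebraic_empty 0).congr
    fun _ hx => hx.elim
  integrableOn := integrableOn_empty

@[simp] theorem emptyRep_domain : emptyRep.domain = ∅ := rfl
@[simp] theorem emptyRep_integrand : emptyRep.integrand = ig := rfl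

@[simp] theorem value_emptyRep : emptyRep.value = 0 := by
  simp [KZ.IntegralRep.value, emptyRep]

/-- **Non-vacuity.** The six hypotheses of `GenusTwoCycleTransfer` are simultaneously satisfiable
(by `rep01, rep23, rep5`). -/
theorem hypotheses_satisfiable :
    ∃ r₁ r₂ r₃ : KZ.IntegralRep 1,
      r₁.domain = {p | 0 < p 0 ∧ p 0 < 1} ∧ EqOn r₁.integrand ig {p | 0 < p 0 ∧ p 0 < 1} ∧
      r₂.domain = {p | 2 < p 0 ∧ p 0 < 3} ∧ EqOn r₂.integrand ig {p | 2 < p 0 ∧ p 0 < 3} ∧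
      r₃.domain = {p | 5 < p 0} ∧ EqOn r₃.integrand ig {p | 5 < p 0} :=
  ⟨rep01, rep23, rep5, rfl, fun _ _ => rfl, rfl, fun _ _ => rfl, rfl, fun _ _ => rfl⟩

/-- Soundness, unfolded: a relation has value `0`. -/
theorem eval_eq_zero_of_mem_relations {c : KZ.FormalRep} (h : c ∈ KZ.relations) : KZ.eval c = 0 :=
  (AddMonoidHom.mem_ker).1 (KZ.relations_le_ker_eval_holds h)

/-- **The `∀`-form is the canonical instance.** `GenusTwoCycleTransfer` is equivalent to the single
membership `[rep01] − [rep23] + [rep5] ∈ KZ.relations`: representations with the same domain whose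
integrands agree on it are congruent modulo relations (`KZ.of_sub_of_mem_relations_of_eqOn`). -/
theorem genusTwoCycleTransfer_iff_canonical :
    GenusTwoCycleTransfer ↔ KZ.of rep01 - KZ.of rep23 + KZ.of rep5 ∈ KZ.relations := by
  constructor
  · intro h
    exact h rep01 rep23 rep5 rfl (fun _ _ => rfl) rfl (fun _ _ => rfl) rfl (fun _ _ => rfl)
  · intro h r₁ r₂ r₃ hd₁ hi₁ hd₂ hi₂ hd₃ hi₃
    have e₁ : KZ.of r₁ - KZ.of rep01 ∈ KZ.relations :=
      KZ.of_sub_of_mem_relations_of_eqOn (by rw [hd₁]; rfl) (by rw [hd₁]; exact hi₁)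
    have e₂ : KZ.of r₂ - KZ.of rep23 ∈ KZ.relations :=
      KZ.of_sub_of_mem_relations_of_eqOn (by rw [hd₂]; rfl) (by rw [hd₂]; exact hi₂)
    have e₃ : KZ.of r₃ - KZ.of rep5 ∈ KZ.relations :=
      KZ.of_sub_of_mem_relations_of_eqOn (by rw [hd₃]; rfl) (by rw [hd₃]; exact hi₃)
    have := KZ.relations.add_mem (KZ.relations.sub_mem (KZ.relations.add_mem h e₁) e₂) e₃
    convert this using 1
    abel

/-! ### §4 Which moves are forced: the relation lies in no obvious sub-calculus -/

/-- **Not derivable by change of variables + Newton–Leibniz alone** (rules (2)+(3)): the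
coefficient sum of `[r₁] − [r₂] + [r₃]` is `1`, while every move of type (2) or (3) is a
difference of two generators (`KZ.closure_cov_nl_le_ker_coeffSum`). So at least one additivity
move is needed — the pencil derivation uses exactly one (`KZ.integrandAddRel`). This holds for
ARBITRARY `r₁ r₂ r₃`. -/
theorem not_mem_closure_cov_nl (r₁ r₂ r₃ : KZ.IntegralRep 1) :
    KZ.of r₁ - KZ.of r₂ + KZ.of r₃ ∉
      AddSubgroup.closure (KZ.changeOfVariablesRel ∪ KZ.newtonLeibnizRel) := by
  intro h
  have := KZ.closure_cov_nl_le_ker_coeffSum h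
  rw [AddMonoidHom.mem_ker] at this
  simp at this

/-- The window family `(5,∞)ⁿ` used for restricted evaluation. -/
def window (n : ℕ) : Set (Fin n → ℝ) := Set.pi univ fun _ => Ioi 5

theorem measurableSet_window (n : ℕ) : MeasurableSet (window n) :=
  MeasurableSet.univ_pi fun _ => measurableSet_Ioi

theorem window_one : window 1 = dom5 := by
  ext p
  simp [window, dom5, Fin.forall_fin_one]

/-- **Not derivable by the two additivity rules alone** ("scissors" sub-calculus, rules (1a)+(1b)):
restricted evaluation through the window `(5,∞)` (`KZ.restrictedEval`, an invariant of the
additivity moves, `KZ.closure_add_le_ker_restrictedEval`) sees only the third oval and gives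
`I₃ > 0`. So a move of type (2) or (3) is needed — the pencil derivation uses three of type (2). -/
theorem not_mem_closure_add (r₁ r₂ r₃ : KZ.IntegralRep 1)
    (hd₁ : r₁.domain = {p | 0 < p 0 ∧ p 0 < 1}) (hd₂ : r₂.domain = {p | 2 < p 0 ∧ p 0 < 3})
    (hd₃ : r₃.domain = {p | 5 < p 0}) (hi₃ : EqOn r₃.integrand ig {p | 5 < p 0}) :
    KZ.of r₁ - KZ.of r₂ + KZ.of r₃ ∉ AddSubgroup.closure (KZ.domainAddRel ∪ KZ.integrandAddRel) := by
  intro h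
  have hk := KZ.closure_add_le_ker_restrictedEval window measurableSet_window h
  rw [AddMonoidHom.mem_ker, map_add, map_sub, KZ.restrictedEval_of, KZ.restrictedEval_of,
    KZ.restrictedEval_of, window_one, hd₁, hd₂, hd₃] at hk
  have e₁ : ({p : Fin 1 → ℝ | 0 < p 0 ∧ p 0 < 1} ∩ dom5) = ∅ := by
    ext p; simp only [dom5, mem_inter_iff, mem_setOf_eq, mem_empty_iff_false, iff_false]
    rintro ⟨⟨-, h1⟩, h5⟩; linarith
  have e₂ : ({p : Fin 1 → ℝ | 2 < p 0 ∧ p 0 < 3} ∩ dom5) = ∅ := by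
    ext p; simp only [dom5, mem_inter_iff, mem_setOf_eq, mem_empty_iff_false, iff_false]
    rintro ⟨⟨-, h1⟩, h5⟩; linarith
  have e₃ : ({p : Fin 1 → ℝ | 5 < p 0} ∩ dom5) = dom5 := inter_self _
  rw [e₁, e₂, e₃] at hk
  simp only [Measure.restrict_empty, integral_zero_measure, sub_zero, zero_add] at hk
  have hI : ∫ p in dom5, r₃.integrand p = rep5.value := by
    rw [KZ.IntegralRep.value, rep5_domain, rep5_integrand]
    exact setIntegral_congr_fun (KZ.IntegralRep.measurableSet_domain_holds rep5) hi₃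
  rw [hI] at hk
  exact value_rep5_pos.ne' hk

/-! ### §5 Load-bearing hypotheses: each of the six is necessary

Scheme: if hypothesis `H` on `rᵢ` is dropped, two admissible choices of `rᵢ` with DIFFERENT values
exist (the canonical one and the empty-domain / zero-integrand one); were both combinations
relations, their difference `[rᵢ] − [rᵢ']` would be a relation of non-zero value, contradicting
soundness (`KZ.relations_le_ker_eval_holds`). -/

section LoadBearing

/-- Two admissible third slots with different values cannot both give relations. -/
theorem not_both_of_value_ne {a b : KZ.FormalRep} {s s' : KZ.IntegralRep 1}
    (hv : s.value ≠ s'.value) (h : a - b + KZ.of s ∈ KZ.relations)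
    (h' : a - b + KZ.of s' ∈ KZ.relations) : False := by
  have hd := KZ.relations.sub_mem h h'
  have : a - b + KZ.of s - (a - b + KZ.of s') = KZ.of s - KZ.of s' := by abel
  rw [this] at hd
  have := eval_eq_zero_of_mem_relations hd
  rw [map_sub, KZ.eval_of, KZ.eval_of, sub_eq_zero] at this
  exact hv this

/-- Same, first slot. -/
theorem not_both_of_value_ne₁ {b c : KZ.FormalRep} {s s' : KZ.IntegralRep 1}
    (hv : s.value ≠ s'.value) (h : KZ.of s - b + c ∈ KZ.relations)
    (h' : KZ.of s' - b + c ∈ KZ.relations) : False := by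
  have hd := KZ.relations.sub_mem h h'
  have : KZ.of s - b + c - (KZ.of s' - b + c) = KZ.of s - KZ.of s' := by abel
  rw [this] at hd
  have := eval_eq_zero_of_mem_relations hd
  rw [map_sub, KZ.eval_of, KZ.eval_of, sub_eq_zero] at this
  exact hv this

/-- Same, second slot. -/
theorem not_both_of_value_ne₂ {a c : KZ.FormalRep} {s s' : KZ.IntegralRep 1}
    (hv : s.value ≠ s'.value) (h : a - KZ.of s + c ∈ KZ.relations)
    (h' : a - KZ.of s' + c ∈ KZ.relations) : False := by
  have hd := KZ.relations.sub_mem h' h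
  have : a - KZ.of s' + c - (a - KZ.of s + c) = KZ.of s - KZ.of s' := by abel
  rw [this] at hd
  have := eval_eq_zero_of_mem_relations hd
  rw [map_sub, KZ.eval_of, KZ.eval_of, sub_eq_zero] at this
  exact hv this

/-- The crux WITHOUT the domain hypothesis on `r₁`. -/
def GenusTwoCycleTransferWithoutDomain₁ : Prop :=
  let f : ℝ → ℝ := fun x => x * (x - 1) * (x - 2) * (x - 3) * (x - 5); ∀ (r₁ r₂ r₃ : Literature.NumberTheory.Transcendental.KZ.IntegralRep 1), Set.EqOn r₁.integrand (fun p => 1 / Real.sqrt (f (p 0))) {p | 0 < p 0 ∧ p 0 < 1} → r₂.domain = {p | 2 < p 0 ∧ p 0 < 3} → Set.EqOn r₂.integrand (fun p => 1 / Real.sqrt (f (p 0))) {p | 2 < p 0 ∧ p 0 < 3} → r₃.domain = {p | 5 < p 0} → Set.EqOn r₃.integrand (fun p => 1 / Real.sqrt (f (p 0))) {p | 5 < p 0} → Literature.NumberTheory.Transcendental.KZ.of r₁ - Literature.NumberTheory.Transcendental.KZ.of r₂ + Literature.NumberTheory.Transcendental.KZ.of r₃ ∈ Literature.NumberTheory.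Transcendental.KZ.relations

/-- The crux WITHOUT the integrand hypothesis on `r₁`. -/
def GenusTwoCycleTransferWithoutIntegrand₁ : Prop :=
  let f : ℝ → ℝ := fun x => x * (x - 1) * (x - 2) * (x - 3) * (x - 5); ∀ (r₁ r₂ r₃ : Literature.NumberTheory.Transcendental.KZ.IntegralRep 1), r₁.domain = {p | 0 < p 0 ∧ p 0 < 1} → r₂.domain = {p | 2 < p 0 ∧ p 0 < 3} → Set.EqOn r₂.integrand (fun p => 1 / Real.sqrt (f (p 0))) {p | 2 < p 0 ∧ p 0 < 3} → r₃.domain = {p | 5 < p 0} → Set.EqOn r₃.integrand (fun p => 1 / Real.sqrt (f (p 0))) {p | 5 < p 0} → Literature.NumberTheory.Transcendental.KZ.of r₁ - Literature.NumberTheory.Transcendental.KZ.of r₂ + Literature.NumberTheory.Transcendental.KZ.of r₃ ∈ Literature.NumberTheory.Transcendental.KZ.relations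

/-- The crux WITHOUT the domain hypothesis on `r₂`. -/
def GenusTwoCycleTransferWithoutDomain₂ : Prop :=
  let f : ℝ → ℝ := fun x => x * (x - 1) * (x - 2) * (x - 3) * (x - 5); ∀ (r₁ r₂ r₃ : Literature.NumberTheory.Transcendental.KZ.IntegralRep 1), r₁.domain = {p | 0 < p 0 ∧ p 0 < 1} → Set.EqOn r₁.integrand (fun p => 1 / Real.sqrt (f (p 0))) {p | 0 < p 0 ∧ p 0 < 1} → Set.EqOn r₂.integrand (fun p => 1 / Real.sqrt (f (p 0))) {p | 2 < p 0 ∧ p 0 < 3} → r₃.domain = {p | 5 < p 0} → Set.EqOn r₃.integrand (fun p => 1 / Real.sqrt (f (p 0))) {p | 5 < p 0} → Literature.NumberTheory.Transcendental.KZ.of r₁ - Literature.NumberTheory.Transcendental.KZ.of r₂ + Literature.NumberTheory.Transcendental.KZ.of r₃ ∈ Literature.NumberTheory.Transcendental.KZ.relations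

/-- The crux WITHOUT the integrand hypothesis on `r₂`. -/
def GenusTwoCycleTransferWithoutIntegrand₂ : Prop :=
  let f : ℝ → ℝ := fun x => x * (x - 1) * (x - 2) * (x - 3) * (x - 5); ∀ (r₁ r₂ r₃ : Literature.NumberTheory.Transcendental.KZ.IntegralRep 1), r₁.domain = {p | 0 < p 0 ∧ p 0 < 1} → Set.EqOn r₁.integrand (fun p => 1 / Real.sqrt (f (p 0))) {p | 0 < p 0 ∧ p 0 < 1} → r₂.domain = {p | 2 < p 0 ∧ p 0 < 3} → r₃.domain = {p | 5 < p 0} → Set.EqOn r₃.integrand (fun p => 1 / Real.sqrt (f (p 0))) {p | 5 < p 0} → Literature.NumberTheory.Transcendental.KZ.of r₁ - Literature.NumberTheory.Transcendental.KZ.of r₂ + Literature.NumberTheory.Transcendental.KZ.of r₃ ∈ Literature.NumberTheory.Transcendental.KZ.relations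

/-- The crux WITHOUT the domain hypothesis on `r₃`. -/
def GenusTwoCycleTransferWithoutDomain₃ : Prop :=
  let f : ℝ → ℝ := fun x => x * (x - 1) * (x - 2) * (x - 3) * (x - 5); ∀ (r₁ r₂ r₃ : Literature.NumberTheory.Transcendental.KZ.IntegralRep 1), r₁.domain = {p | 0 < p 0 ∧ p 0 < 1} → Set.EqOn r₁.integrand (fun p => 1 / Real.sqrt (f (p 0))) {p | 0 < p 0 ∧ p 0 < 1} → r₂.domain = {p | 2 < p 0 ∧ p 0 < 3} → Set.EqOn r₂.integrand (fun p => 1 / Real.sqrt (f (p 0))) {p | 2 < p 0 ∧ p 0 < 3} → Set.EqOn r₃.integrand (fun p => 1 / Real.sqrt (f (p 0))) {p | 5 < p 0} → Literature.NumberTheory.Transcendental.KZ.of r₁ - Literature.NumberTheory.Transcendental.KZ.of r₂ + Literature.NumberTheory.Transcendental.KZ.of r₃ ∈ Literature.NumberTheory.Transcendental.KZ.relations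

/-- The crux WITHOUT the integrand hypothesis on `r₃`. -/
def GenusTwoCycleTransferWithoutIntegrand₃ : Prop :=
  let f : ℝ → ℝ := fun x => x * (x - 1) * (x - 2) * (x - 3) * (x - 5); ∀ (r₁ r₂ r₃ : Literature.NumberTheory.Transcendental.KZ.IntegralRep 1), r₁.domain = {p | 0 < p 0 ∧ p 0 < 1} → Set.EqOn r₁.integrand (fun p => 1 / Real.sqrt (f (p 0))) {p | 0 < p 0 ∧ p 0 < 1} → r₂.domain = {p | 2 < p 0 ∧ p 0 < 3} → Set.EqOn r₂.integrand (fun p => 1 / Real.sqrt (f (p 0))) {p | 2 < p 0 ∧ p 0 < 3} → r₃.domain = {p | 5 < p 0} → Literature.NumberTheory.Transcendental.KZ.of r₁ - Literature.NumberTheory.Transcendental.KZ.of r₂ + Literature.NumberTheory.Transcendental.KZ.of r₃ ∈ Literature.NumberTheory.Transcendental.KZ.relations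

/-- Any proof must use the domain hypothesis on `r₁` (witnesses `rep01` vs `emptyRep`). -/
theorem genusTwoCycleTransfer_false_without_domain₁ : ¬ GenusTwoCycleTransferWithoutDomain₁ := by
  intro H
  have h := H rep01 rep23 rep5 (fun _ _ => rfl) rfl (fun _ _ => rfl) rfl (fun _ _ => rfl)
  have h' := H emptyRep rep23 rep5 (fun _ _ => rfl) rfl (fun _ _ => rfl) rfl (fun _ _ => rfl)
  exact not_both_of_value_ne₁ (by rw [value_emptyRep]; exact value_rep01_pos.ne') h h'

/-- Any proof must use the integrand hypothesis on `r₁` (witnesses `rep01` vs the zero integrand). -/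
theorem genusTwoCycleTransfer_false_without_integrand₁ : ¬ GenusTwoCycleTransferWithoutIntegrand₁ := by
  intro H
  have h := H rep01 rep23 rep5 rfl rfl (fun _ _ => rfl) rfl (fun _ _ => rfl)
  have h' := H (zeroRep isSemialgebraic_dom01) rep23 rep5 rfl rfl (fun _ _ => rfl) rfl (fun _ _ => rfl)
  exact not_both_of_value_ne₁ (by rw [value_zeroRep]; exact value_rep01_pos.ne') h h'

/-- Any proof must use the domain hypothesis on `r₂`. -/
theorem genusTwoCycleTransfer_false_without_domain₂ : ¬ GenusTwoCycleTransferWithoutDomain₂ := by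
  intro H
  have h := H rep01 rep23 rep5 rfl (fun _ _ => rfl) (fun _ _ => rfl) rfl (fun _ _ => rfl)
  have h' := H rep01 emptyRep rep5 rfl (fun _ _ => rfl) (fun _ _ => rfl) rfl (fun _ _ => rfl)
  exact not_both_of_value_ne₂ (by rw [value_emptyRep]; exact value_rep23_pos.ne') h h'

/-- Any proof must use the integrand hypothesis on `r₂`. -/
theorem genusTwoCycleTransfer_false_without_integrand₂ : ¬ GenusTwoCycleTransferWithoutIntegrand₂ := by
  intro H
  have h := H rep01 rep23 rep5 rfl (fun _ _ => rfl) rfl rfl (fun _ _ => rfl)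
  have h' := H rep01 (zeroRep isSemialgebraic_dom23) rep5 rfl (fun _ _ => rfl) rfl rfl (fun _ _ => rfl)
  exact not_both_of_value_ne₂ (by rw [value_zeroRep]; exact value_rep23_pos.ne') h h'

/-- Any proof must use the domain hypothesis on `r₃` (in particular the UNBOUNDED oval cannot be
dropped or shrunk to nothing). -/
theorem genusTwoCycleTransfer_false_without_domain₃ : ¬ GenusTwoCycleTransferWithoutDomain₃ := by
  intro H
  have h := H rep01 rep23 rep5 rfl (fun _ _ => rfl) rfl (fun _ _ => rfl) (fun _ _ => rfl)
  have h' := H rep01 rep23 emptyRep rfl (fun _ _ => rfl) rfl (fun _ _ => rfl) (fun _ _ => rfl)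
  exact not_both_of_value_ne (by rw [value_emptyRep]; exact value_rep5_pos.ne') h h'

/-- Any proof must use the integrand hypothesis on `r₃`. -/
theorem genusTwoCycleTransfer_false_without_integrand₃ : ¬ GenusTwoCycleTransferWithoutIntegrand₃ := by
  intro H
  have h := H rep01 rep23 rep5 rfl (fun _ _ => rfl) rfl (fun _ _ => rfl) rfl
  have h' := H rep01 rep23 (zeroRep isSemialgebraic_dom5) rfl (fun _ _ => rfl) rfl (fun _ _ => rfl) rfl
  exact not_both_of_value_ne (by rw [value_zeroRep]; exact value_rep5_pos.ne') h h'

end LoadBearing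

/-! ### §5bis Sign patterns -/

/-- **The all-plus combination is not a relation**: its value is `I₁ + I₂ + I₃ > 0`. (The crux's
pattern `(+,−,+)` is the real part of the boundary phases `+1, −1, +1` of the upper-half-plane
branch of `1/√f`; numerically it is the ONLY vanishing sign pattern.) -/
theorem all_plus_not_mem_relations (r₁ r₂ r₃ : KZ.IntegralRep 1)
    (hd₁ : r₁.domain = {p | 0 < p 0 ∧ p 0 < 1}) (hi₁ : EqOn r₁.integrand ig {p | 0 < p 0 ∧ p 0 < 1})
    (hd₂ : r₂.domain = {p | 2 < p 0 ∧ p 0 < 3}) (hi₂ : EqOn r₂.integrand ig {p | 2 < p 0 ∧ p 0 < 3})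
    (hd₃ : r₃.domain = {p | 5 < p 0}) (hi₃ : EqOn r₃.integrand ig {p | 5 < p 0}) :
    KZ.of r₁ + KZ.of r₂ + KZ.of r₃ ∉ KZ.relations := by
  intro h
  have hv := eval_eq_zero_of_mem_relations h
  rw [map_add, map_add, KZ.eval_of, KZ.eval_of, KZ.eval_of] at hv
  have v₁ : r₁.value = rep01.value := by
    rw [KZ.IntegralRep.value, KZ.IntegralRep.value, hd₁]
    exact setIntegral_congr_fun (KZ.IntegralRep.measurableSet_domain_holds rep01) hi₁
  have v₂ : r₂.value = rep23.value := by
    rw [KZ.IntegralRep.value, KZ.IntegralRep.value, hd₂]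
    exact setIntegral_congr_fun (KZ.IntegralRep.measurableSet_domain_holds rep23) hi₂
  have v₃ : r₃.value = rep5.value := by
    rw [KZ.IntegralRep.value, KZ.IntegralRep.value, hd₃]
    exact setIntegral_congr_fun (KZ.IntegralRep.measurableSet_domain_holds rep5) hi₃
  rw [v₁, v₂, v₃] at hv
  linarith [value_rep01_pos, value_rep23_pos, value_rep5_pos]

/-! ### §6 Why no crux-local counterexample exists: summit + value identity ⇒ crux -/

/-- **A refutation of the crux would refute the summit** (modulo the certified value identity).
If `I₁ − I₂ + I₃ = 0` — Cauchy's theorem for `dz/√f` on the upper half-plane; numerically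
`(0.8026145263330726) − (1.059673979560619) + (0.25705945322754614) = 4·10⁻¹⁶` — then the summit
`KontsevichZagierPeriods` (equivalently its kernel form, `kzKernelConjecture_iff_isRational`,
proved in tree) implies `GenusTwoCycleTransfer`. Hence any additive invariant of `KZ.FormalRep`
vanishing on the four move sets but not on `[r₁] − [r₂] + [r₃]` would disprove the summit itself
(route HermiteRigidity, KILL CRITERIA). -/
theorem GenusTwoCycleTransfer_of_kontsevichZagierPeriods
    (hval : rep01.value - rep23.value + rep5.value = 0) (hKZ : KontsevichZagierPeriods) :
    GenusTwoCycleTransfer := by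
  have hK : KZKernelConjecture := kzKernelConjecture_iff_isRational.mpr hKZ
  rw [genusTwoCycleTransfer_iff_canonical]
  apply hK
  simp only [map_add, map_sub, KZ.eval_of]
  exact hval

/-! ### §7 Pointers to the landed modules

The period order `I₃ < I₁ < I₂` and its consequences (`not_equivalent₁₂/₁₃/₂₃`,
`sign_pattern_of_mem_relations`, `truncation_not_mem_relations`) live in
`Theorems/GenusTwoCycleTransfer/Negative/Bounds.lean` (landed, p73395) and `…/OvalOrder.lean`
(proposed); the def-free load-bearing theorems in `…/LoadBearing.lean` (p73324), re-exported here: -/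

/-- Landed form of §5 (first domain hypothesis), re-exported from `Negative/LoadBearing.lean`. -/
example : ¬ (let f : ℝ → ℝ := fun x => x * (x - 1) * (x - 2) * (x - 3) * (x - 5); ∀ (r₁ r₂ r₃ : Literature.NumberTheory.Transcendental.KZ.IntegralRep 1), Set.EqOn r₁.integrand (fun p => 1 / Real.sqrt (f (p 0))) {p | 0 < p 0 ∧ p 0 < 1} → r₂.domain = {p | 2 < p 0 ∧ p 0 < 3} → Set.EqOn r₂.integrand (fun p => 1 / Real.sqrt (f (p 0))) {p | 2 < p 0 ∧ p 0 < 3} → r₃.domain = {p | 5 < p 0} → Set.EqOn r₃.integrand (fun p => 1 / Real.sqrt (f (p 0))) {p | 5 < p 0} → Literature.NumberTheory.Transcendental.KZ.of r₁ - Literature.NumberTheory.Transcendental.KZ.of r₂ + Literature.NumberTheory.Transcendental.KZ.of r₃ ∈ Literature.NumberTheory.Transcendental.KZ.relations) :=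
  Summit.KontsevichZagierPeriods.HermiteRigidity.GenusTwoCycleTransferNegative.genusTwoCycleTransfer_false_without_domain₁

end Summit.KontsevichZagierPeriods.KontsevichZagierPeriods.Cruxes.GenusTwoCycleTransfer.Disproof

end
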